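import Literature.NumberTheory.Sieve.MatomakiRadziwillProp1U1
import Literature.NumberTheory.LFunctions.DirichletPolynomialLargeValuesSharp
import Literature.NumberTheory.LFunctions.DirichletPolynomialDiscreteMeanValue
import Literature.NumberTheory.LFunctions.HalaszMontgomeryInequality
import HarnessLib

/-!
# Matomäki–Radziwiłł 2016, Proposition 1 — part (d2): discretisation of `∫_𝒰` and the point count (§8.3)

Topic `NumberTheory/Sieve`; fifth file of the assembly of `MatomakiRadziwill2016_prop1` (Proposition 1 of
K. Matomäki, M. Radziwiłł, *Multiplicative functions in short intervals*, Ann. of Math. 183 (2016), §8),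
after `MatomakiRadziwillProp1Partition.lean` (a), `MatomakiRadziwillProp1E1.lean` (b),
`MatomakiRadziwillProp1Ej.lean` (c), `MatomakiRadziwillProp1U1.lean` (d1).  Everything is proved.

§8.3 of the paper, after the second application of Lemma 12 (file (d1)): "We then find a well-spaced set
`𝒯 ⊆ 𝒰` such that `∫_𝒰 |Q_{v,H}(1+it) R_{v,H}(1+it)|² dt ≤ 2 ∑_{t ∈ 𝒯} |Q_{v,H}(1+it) R_{v,H}(1+it)|²`.
… Now, by definition of `𝒰`, for each `t ∈ 𝒯` there is `v ∈ ℐ_J` such that `|Q_{v,H_J}(s)| > e^{-α_J v/H_J}`.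
Applying Lemma 8 to `Q_{v,H_J}(s)` for every `v ∈ ℐ_J` we get `|𝒯| ≪ |ℐ_J| T^{2α_J+o(1)} T^η X^{o(1)}
≪ T^{1/2-η} X^{o(1)}`. … By Lemma 9, `∑_{t ∈ 𝒯_S} |Q_{v,H} R_{v,H}|² ≪ (log X)^{-200} ∑_{t ∈ 𝒯} |R_{v,H}(1+it)|²
≪ (log X)^{-200} (X e^{-v/H} + |𝒯| T^{1/2}) log(2T) (X e^{-v/H})⁻¹`."  This file proves:

* `MatomakiRadziwillU.discretisation` — the discretisation, for any continuous `g ≥ 0` and measurable `U`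
  inside a closed `K ⊆ [T₀, T]`: maximisers of `g` on the unit cells `K ∩ [n, n+1]`, split by the parity of
  `n`, give two `1`-spaced sets `𝒯₀, 𝒯₁ ⊆ K` with `∫_U g ≤ ∑_{𝒯₀} g + ∑_{𝒯₁} g` (the paper's factor `2`);
* `SieveIntervalSystem.Uset_discretisation` — the same for `𝒰`, with `K` the closed set of `t ∈ [T₀, T]`
  having, at every level `j ≤ J`, a witness `v ∈ ℐ_j` with `|Q_{v,H_j}(1+it)| ≥ e^{-α_j v/H_j}`;
* `SieveIntervalSystem.card_witness_le` — the point count, explicit: for `X^{1/4} ≤ T ≤ X`, `log X ≥ 400`,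
  `H₁ ≥ 2`, a `1`-spaced set of such points in `[T₀, T]`, `T₀ ≥ 0`, has
  `#𝒯 ≤ #ℐ_J · C₈ e^{(√log X)/2} X^{1/2-2η}` (Lemma 8 in the sharp form
  `LFunctions.DirichletLargeValues.MatomakiRadziwill2016_lemma8_sharp`, whose hypothesis `P² ≤ T` is why
  `T ≥ X^{1/4}` — smaller `T` are handled by monotonicity in the final assembly; the saving
  `exp(4 (log T/log P_J) log log T) ≤ X^{2η/(J+1)²}` is condition (2) at `J+1` with `Q_{J+1} > e^{√log X}`,
  `loglogX_lt`, and `2α_J + 2η/(J+1)² ≤ 1/2 - 2η`);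
* `MatomakiRadziwillU.lemma9_subset`, `MatomakiRadziwillU.sum_norm_sq_cofactor_le` — Lemma 9 for a
  polynomial supported on `s ⊆ [1, N]` with weights `n^{-1-it}`, and for the cofactor polynomial:
  `∑_{t ∈ 𝒯} |R_{v,H}(1+it)|² ≤ C₉ (2X' + |𝒯| √T) log(2T) (2/X')`, `X' = X e^{-v/H} ≥ 1`;
  `sum_filter_small_le` — the `𝒯_S` step `∑_{|Q| < B⁻¹} |QR|² ≤ B⁻² ∑ |R|²`;
* `lemma8With_exists`, `lemma9With_exists` (unconditional: Lemmas 7, 8♯, 9 are proved in the tree),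
  `lemma11With_of`, `lemma3With_of` (from the named facts `MatomakiRadziwill2016_lemma11`,
  `MatomakiRadziwill2016_lemma3`): the constants of Lemmas 8, 9, 11 (`ε = 1/10`), 3 (`A = 2`), made nonnegative;
  the hypothesis shapes "Lemma n holds with constant `C`" are written with the file-local notations
  `(∀ (P T V : ℝ) (a : ℕ → ℂ) (𝒯 : Finset ℝ), 2 ≤ P → P ^ 2 ≤ T →
      Real.exp (Real.exp 4) ≤ T → 1 ≤ V → (∀ p, ‖a p‖ ≤ 1) → (∀ t ∈ 𝒯, |t| ≤ T) →
      (∀ t ∈ 𝒯, ∀ t' ∈ 𝒯, t ≠ t' → 1 ≤ |t - t'|) →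
      (∀ t ∈ 𝒯, V⁻¹ ≤ ‖∑ p ∈ (Finset.Icc ⌈P⌉₊ ⌊2 * P⌋₊).filter Nat.Prime,
          a p * (p : ℂ) ^ (-(1 + (t : ℂ) * Complex.I))‖) →
      ((Finset.card 𝒯 : ℕ) : ℝ) ≤ C * V ^ 2 * T ^ (2 * Real.log V / Real.log P)
        * Real.exp (4 * (Real.log T / Real.log P) * Real.log (Real.log T)))`, `(∀ (N : ℕ) (a : ℕ → ℂ) (T : ℝ) (𝒯 : Finset ℝ), 1 ≤ N → 1 ≤ T →
      (∀ t ∈ 𝒯, |t| ≤ T) → (∀ t ∈ 𝒯, ∀ t' ∈ 𝒯, t ≠ t' → 1 ≤ |t - t'|) →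
      ∑ t ∈ 𝒯, ‖∑ n ∈ Finset.Icc 1 N, a n * (n : ℂ) ^ (-((t : ℂ) * Complex.I))‖ ^ 2 ≤
        C * (N + (Finset.card 𝒯 : ℕ) * Real.sqrt T) * Real.log (2 * T) * ∑ n ∈ Finset.Icc 1 N, ‖a n‖ ^ 2)`, `(∀ (P T : ℝ) (a : ℕ → ℂ) (𝒯 : Finset ℝ), 2 ≤ P → 2 ≤ T →
      (∀ t ∈ 𝒯, |t| ≤ T) → (∀ t ∈ 𝒯, ∀ t' ∈ 𝒯, t ≠ t' → 1 ≤ |t - t'|) →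
      ∑ t ∈ 𝒯, ‖∑ p ∈ (Finset.Icc ⌈P⌉₊ ⌊2 * P⌋₊).filter Nat.Prime,
          a p * (p : ℂ) ^ (-((t : ℂ) * Complex.I))‖ ^ 2 ≤
        C * (P + ((Finset.card 𝒯 : ℕ) : ℝ) * P * Real.exp (-(Real.log P / Real.log T ^ (2 / 3 + 1 / 10 : ℝ)))
            * Real.log T ^ 2)
          * ∑ p ∈ (Finset.Icc ⌈P⌉₊ ⌊2 * P⌋₊).filter Nat.Prime, ‖a p‖ ^ 2 / Real.log P)`, `(∀ f : ArithmeticFunction ℝ, f.IsMultiplicative → (∀ n, |f n| ≤ 1) →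
      ∀ X P Q t : ℝ, 2 ≤ P → P ≤ Q → Q ≤ X → Real.log X ^ (1 / 16 : ℝ) ≤ t → t ≤ X ^ (2 : ℝ) →
        ‖∑ n ∈ Finset.Icc ⌈X⌉₊ ⌊2 * X⌋₊,
            (f n : ℂ) * (n : ℂ) ^ (-(1 + (t : ℂ) * Complex.I)) / ((primeDivisorsIn P Q n : ℂ) + 1)‖ ≤
          C * (Real.log Q / (Real.log X ^ (1 / 16 : ℝ) * Real.log P)
            + Real.log X * Real.exp (-(Real.log X / (3 * Real.log Q)) * Real.log (Real.log X / Real.log Q))))` (no declarations).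

What remains for §8.3 (later files): the large values `𝒯_L` (Lemma 8 count, Lemma 11, the Halász bound of
Lemma 3 with Lemma 5, Brun–Titchmarsh for the prime block) and the final numerical assembly with
`P = exp((log X)^{97/100})`, `Q = exp((log X)^{99/100})`, `H = (log X)^{1/50}`.

## References

* K. Matomäki, M. Radziwiłł, *Multiplicative functions in short intervals*, Ann. of Math. (2) 183
  (2016), 1015–1056, doi:10.4007/annals.2016.183.3.6, arXiv:1501.04585: §8.3 (arXiv p. 17), Lemmas 3, 8,
  9, 11 (§§3–4).
-/

noncomputable section

open Finset Complex MeasureTheory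

namespace Literature.NumberTheory.Sieve

namespace MatomakiRadziwillU

/-! ### Discretisation of an integral over a thin set into well-spaced points -/

/-- Points chosen in unit cells `[n, n+1]` with indices of the same parity are `1`-separated. [folklore] -/
theorem sep_of_parity {τ : ℕ → ℝ} {n n' : ℕ} (hn : τ n ∈ Set.Icc (n : ℝ) (n + 1))
    (hn' : τ n' ∈ Set.Icc (n' : ℝ) (n' + 1)) (hpar : n % 2 = n' % 2) (hne : n ≠ n') :
    1 ≤ |τ n - τ n'| := by
  rcases hn with ⟨h1, h2⟩
  rcases hn' with ⟨h1', h2'⟩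
  have h : n + 2 ≤ n' ∨ n' + 2 ≤ n := by omega
  rcases h with h | h
  · have : (n : ℝ) + 2 ≤ n' := by exact_mod_cast h
    rw [abs_sub_comm, abs_of_nonneg (by linarith)]
    linarith
  · have : (n' : ℝ) + 2 ≤ n := by exact_mod_cast h
    rw [abs_of_nonneg (by linarith)]
    linarith

/-- **Discretisation** ("we then find a well-spaced set `𝒯 ⊆ 𝒰` such that
`∫_𝒰 |Q R|² dt ≤ 2 ∑_{t ∈ 𝒯} |Q R|²`", §8.3): for a continuous `g ≥ 0`, a measurable `U` contained in a
closed `K ⊆ [T₀, T]` (`T₀ ≥ 0`), there are two `1`-spaced finite sets `𝒯₀, 𝒯₁ ⊆ K` (maximisers of `g` on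
`K ∩ [n, n+1]` for even, resp. odd, `n`) with `∫_U g ≤ ∑_{t ∈ 𝒯₀} g(t) + ∑_{t ∈ 𝒯₁} g(t)`.
[cite: MatomakiRadziwillAnnals2016, §8.3] -/
theorem discretisation {g : ℝ → ℝ} (hg : Continuous g) (hg0 : ∀ t, 0 ≤ g t) {K U : Set ℝ}
    (hK : IsClosed K) (hUK : U ⊆ K) (hU : MeasurableSet U) {T₀ T : ℝ} (hT₀ : 0 ≤ T₀)
    (hKsub : K ⊆ Set.Icc T₀ T) :
    ∃ 𝒯 : Fin 2 → Finset ℝ, (∀ i, ∀ t ∈ 𝒯 i, t ∈ K) ∧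
      (∀ i, ∀ t ∈ 𝒯 i, ∀ t' ∈ 𝒯 i, t ≠ t' → 1 ≤ |t - t'|) ∧
      ∫ t in U, g t ≤ ∑ i, ∑ t ∈ 𝒯 i, g t := by
  classical
  -- unit cells and maximisers
  set Kn : ℕ → Set ℝ := fun n => K ∩ Set.Icc (n : ℝ) (n + 1) with hKn
  have hKc : ∀ n, IsCompact (Kn n) := fun n => isCompact_Icc.inter_left hK
  have hex : ∀ n, (Kn n).Nonempty → ∃ t ∈ Kn n, IsMaxOn g (Kn n) t := fun n hn =>
    (hKc n).exists_isMaxOn hn hg.continuousOn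
  choose! τ hτ using hex
  set N : Finset ℕ := (Finset.Icc ⌊T₀⌋₊ ⌈T⌉₊).filter (fun n => (Kn n).Nonempty) with hN
  have hmemN : ∀ {n}, n ∈ N → τ n ∈ Kn n := fun hn => (hτ _ (Finset.mem_filter.1 hn).2).1
  have hsep : ∀ {n n'}, n ∈ N → n' ∈ N → n % 2 = n' % 2 → n ≠ n' → 1 ≤ |τ n - τ n'| :=
    fun hn hn' hpar hne => sep_of_parity (hmemN hn).2 (hmemN hn').2 hpar hne
  have hinj : ∀ i : ℕ, Set.InjOn τ ↑(N.filter (fun n => n % 2 = i)) := by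
    intro i n hn n' hn' heq
    rw [Finset.coe_filter, Set.mem_setOf_eq] at hn hn'
    by_contra hne
    have := hsep hn.1 hn'.1 (hn.2.trans hn'.2.symm) hne
    rw [heq, sub_self, abs_zero] at this
    linarith
  refine ⟨fun i => (N.filter (fun n => n % 2 = (i : ℕ))).image τ, ?_, ?_, ?_⟩
  · intro i t ht
    obtain ⟨n, hn, rfl⟩ := Finset.mem_image.1 ht
    exact (hmemN (Finset.mem_filter.1 hn).1).1
  · intro i t ht t' ht' hne
    obtain ⟨n, hn, rfl⟩ := Finset.mem_image.1 ht
    obtain ⟨n', hn', rfl⟩ := Finset.mem_image.1 ht'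
    have hn1 := Finset.mem_filter.1 hn
    have hn1' := Finset.mem_filter.1 hn'
    refine hsep hn1.1 hn1'.1 (hn1.2.trans hn1'.2.symm) ?_
    rintro rfl
    exact hne rfl
  · -- the integral: `U = ⋃_n U ∩ [n, n+1)`
    set S : ℕ → Set ℝ := fun n => U ∩ Set.Ico (n : ℝ) (n + 1) with hS
    have hSK : ∀ n, S n ⊆ Kn n := fun n t ht => ⟨hUK ht.1, Set.Ico_subset_Icc_self ht.2⟩
    have hUeq : U = ⋃ n ∈ Finset.Icc ⌊T₀⌋₊ ⌈T⌉₊, S n := by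
      ext t
      simp only [Set.mem_iUnion, exists_prop]
      constructor
      · intro ht
        have htT := hKsub (hUK ht)
        have ht0 : 0 ≤ t := hT₀.trans htT.1
        refine ⟨⌊t⌋₊, Finset.mem_Icc.2 ⟨Nat.floor_le_floor htT.1, ?_⟩, ht, Nat.floor_le ht0,
          Nat.lt_floor_add_one t⟩
        exact (Nat.floor_le_ceil t).trans (Nat.ceil_mono htT.2)
      · rintro ⟨n, -, ht, -⟩
        exact ht
    have hdisj : Set.Pairwise (↑(Finset.Icc ⌊T₀⌋₊ ⌈T⌉₊)) (Function.onFun Disjoint S) := by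
      intro n _ n' _ hne
      refine Set.disjoint_left.2 fun t ht ht' => hne ?_
      have h1 := ht.2.1; have h2 := ht.2.2; have h1' := ht'.2.1; have h2' := ht'.2.2
      have e1 : (n : ℝ) < n' + 1 := by linarith
      have e2 : (n' : ℝ) < n + 1 := by linarith
      have e1' : n < n' + 1 := by exact_mod_cast e1
      have e2' : n' < n + 1 := by exact_mod_cast e2
      omega
    have hint : ∀ n ∈ Finset.Icc ⌊T₀⌋₊ ⌈T⌉₊, IntegrableOn g (S n) := fun n _ =>
      (hg.integrableOn_Icc (a := (n : ℝ)) (b := n + 1)).mono_set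
        ((Set.inter_subset_right).trans Set.Ico_subset_Icc_self)
    have hmeas : ∀ n ∈ Finset.Icc ⌊T₀⌋₊ ⌈T⌉₊, MeasurableSet (S n) := fun n _ =>
      hU.inter measurableSet_Ico
    rw [hUeq, integral_biUnion_finset _ hmeas hdisj hint]
    -- each cell contributes at most `g(τ n)` (and nothing if `K ∩ [n, n+1] = ∅`)
    have hcell : ∀ n ∈ Finset.Icc ⌊T₀⌋₊ ⌈T⌉₊,
        ∫ t in S n, g t ≤ if (Kn n).Nonempty then g (τ n) else 0 := by
      intro n _
      by_cases h : (Kn n).Nonempty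
      · rw [if_pos h]
        have hfin : volume (S n) < ⊤ :=
          (measure_mono (Set.inter_subset_right)).trans_lt (by rw [Real.volume_Ico]; simp)
        have hle : ∀ t ∈ S n, ‖g t‖ ≤ g (τ n) := fun t ht => by
          rw [Real.norm_eq_abs, abs_of_nonneg (hg0 t)]
          exact (hτ n h).2 (hSK n ht)
        have h1 := norm_setIntegral_le_of_norm_le_const hfin hle
        have h2 : volume.real (S n) ≤ 1 := by
          calc volume.real (S n) ≤ volume.real (Set.Ico (n : ℝ) (n + 1)) :=
                measureReal_mono (Set.inter_subset_right) (by rw [Real.volume_Ico]; simp)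
            _ = 1 := by rw [Real.volume_real_Ico]; simp
        have h3 : 0 ≤ g (τ n) := hg0 _
        calc ∫ t in S n, g t ≤ ‖∫ t in S n, g t‖ := Real.le_norm_self _
          _ ≤ g (τ n) * volume.real (S n) := h1
          _ ≤ g (τ n) * 1 := mul_le_mul_of_nonneg_left h2 h3
          _ = g (τ n) := mul_one _
      · rw [if_neg h]
        have : S n = ∅ := Set.subset_eq_empty (hSK n) (Set.not_nonempty_iff_eq_empty.1 h)
        rw [this, Measure.restrict_empty, integral_zero_measure]
    refine (Finset.sum_le_sum hcell).trans (le_of_eq ?_)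
    rw [← Finset.sum_filter]
    -- split `N` by parity and identify with the image sums
    simp only [Fin.sum_univ_two, Fin.val_zero, Fin.val_one]
    rw [Finset.sum_image (hinj 0), Finset.sum_image (hinj 1),
      ← Finset.sum_filter_add_sum_filter_not N (fun n => n % 2 = 0)]
    congr 1
    refine Finset.sum_congr ?_ fun _ _ => rfl
    ext n
    simp only [Finset.mem_filter, Nat.mod_two_ne_zero]

end MatomakiRadziwillU

namespace SieveIntervalSystem

variable {η X : ℝ} (I : SieveIntervalSystem η X)

/-! ### The discretisation of `∫_𝒰` with level-`J` witnesses -/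

/-- `𝒰` is contained in the closed set
`K = [T₀, T] ∩ ⋂_{j ≤ J} ⋃_{v ∈ ℐ_j} {t : e^{-α_j v/H_j} ≤ |Q_{v,H_j}(1+it)|}` ("by definition of `𝒰`, for
each `t ∈ 𝒯` there is `v ∈ ℐ_J` such that `|Q_{v,H_J}(1+it)| > e^{-α_J v/H_J}`", §8.3). [cite: MatomakiRadziwillAnnals2016, §8.3] -/
theorem Uset_subset_witness (c : ℕ → ℂ) (T₀ T : ℝ) :
    I.Uset c T₀ T ⊆ Set.Icc T₀ T ∩ ⋂ j ∈ Icc 1 I.J, ⋃ v ∈ I.blocks j,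
      {t : ℝ | Real.exp (-(alpha η j * v / I.Hpar j)) ≤
        ‖blockPrimePoly c (I.P j) (I.Q j) (I.Hpar j) v t‖} := by
  intro t ht
  refine ⟨ht.1, ?_⟩
  have h2 := ht.2
  simp only [Set.mem_iInter, Set.mem_compl_iff, goodSet, not_forall, Set.mem_setOf_eq, not_le,
    exists_prop] at h2
  simp only [Set.mem_iInter, Set.mem_iUnion, Set.mem_setOf_eq, exists_prop]
  intro j hj
  obtain ⟨v, hv, hlt⟩ := h2 j hj
  exact ⟨v, hv, hlt.le⟩

/-- The witness set `K` is closed. [folklore] -/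
theorem isClosed_witness (c : ℕ → ℂ) (T₀ T : ℝ) :
    IsClosed (Set.Icc T₀ T ∩ ⋂ j ∈ Icc 1 I.J, ⋃ v ∈ I.blocks j,
      {t : ℝ | Real.exp (-(alpha η j * v / I.Hpar j)) ≤
        ‖blockPrimePoly c (I.P j) (I.Q j) (I.Hpar j) v t‖}) := by
  refine isClosed_Icc.inter (isClosed_biInter fun j _ => ?_)
  refine isClosed_biUnion_finset fun v _ => ?_
  refine isClosed_le continuous_const ?_
  have : Continuous fun t : ℝ => blockPrimePoly c (I.P j) (I.Q j) (I.Hpar j) v t := by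
    unfold blockPrimePoly
    exact MatomakiRadziwillLemma12.continuous_dsum _ _
  exact this.norm

/-- **Discretisation of `∫_𝒰`** (§8.3): for continuous `g ≥ 0` and `T₀ ≥ 0` there are two `1`-spaced finite
sets `𝒯₀, 𝒯₁ ⊂ [T₀, T]` of points each of which has, at every level `j ≤ J`, a witness `v ∈ ℐ_j` with
`|Q_{v,H_j}(1+it)| ≥ e^{-α_j v/H_j}`, and `∫_𝒰 g ≤ ∑_{t ∈ 𝒯₀} g(t) + ∑_{t ∈ 𝒯₁} g(t)`.
[cite: MatomakiRadziwillAnnals2016, §8.3] -/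
theorem Uset_discretisation (c : ℕ → ℂ) {T₀ T : ℝ} (hT₀ : 0 ≤ T₀) {g : ℝ → ℝ} (hg : Continuous g)
    (hg0 : ∀ t, 0 ≤ g t) :
    ∃ 𝒯 : Fin 2 → Finset ℝ,
      (∀ i, ∀ t ∈ 𝒯 i, t ∈ Set.Icc T₀ T ∧ ∀ j ∈ Icc 1 I.J, ∃ v ∈ I.blocks j,
        Real.exp (-(alpha η j * v / I.Hpar j)) ≤ ‖blockPrimePoly c (I.P j) (I.Q j) (I.Hpar j) v t‖) ∧
      (∀ i, ∀ t ∈ 𝒯 i, ∀ t' ∈ 𝒯 i, t ≠ t' → 1 ≤ |t - t'|) ∧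
      ∫ t in I.Uset c T₀ T, g t ≤ ∑ i, ∑ t ∈ 𝒯 i, g t := by
  obtain ⟨𝒯, hK, hws, hint⟩ := MatomakiRadziwillU.discretisation hg hg0 (I.isClosed_witness c T₀ T)
    (I.Uset_subset_witness c T₀ T) (I.measurableSet_Uset c T₀ T) hT₀ (fun t ht => ht.1)
  refine ⟨𝒯, fun i t ht => ?_, hws, hint⟩
  have h := hK i t ht
  refine ⟨h.1, fun j hj => ?_⟩
  have h2 := h.2
  simp only [Set.mem_iInter, Set.mem_iUnion, Set.mem_setOf_eq, exists_prop] at h2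
  exact h2 j hj

/-! ### Counting the points: Lemma 8 at level `J` -/

/-- `e^4 ≤ 55`. [folklore] -/
theorem exp_four_le : Real.exp 4 ≤ 55 := by
  have h := Real.exp_one_lt_d9
  have : Real.exp 4 = Real.exp 1 ^ 4 := by rw [← Real.exp_nat_mul]; norm_num
  rw [this]
  have h0 : 0 ≤ Real.exp 1 := (Real.exp_pos 1).le
  nlinarith [pow_le_pow_left₀ h0 h.le 4]

/-- From condition (2) at `J + 1` and `Q_{J+1} > exp(√log X)`:
`2 (J+1)² log log X < η (log P_J - 1)` ("`log P_J ≥ (4j²/η) log log Q_{J+1} ≥ (4j²/η) log (log X)^{1/2}`",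
§8.3), for `log X > 1`. [cite: MatomakiRadziwillAnnals2016, §8.3] -/
theorem loglogX_lt (hX : 1 < Real.log X) :
    2 * ((I.J : ℝ) + 1) ^ 2 * Real.log (Real.log X) < η * (Real.log (I.P I.J) - 1) := by
  have h2 := I.notTooFar (I.J + 1) (by linarith [I.one_le_J])
  simp only [Nat.add_sub_cancel] at h2
  have hlt := I.lt_Q_succ
  have hL0 : 0 < Real.log X := by linarith
  have h1 : Real.sqrt (Real.log X) < Real.log (I.Q (I.J + 1)) := by
    have := Real.log_lt_log (Real.exp_pos _) hlt
    rwa [Real.log_exp] at this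
  have hsqrt0 : 0 < Real.sqrt (Real.log X) := Real.sqrt_pos.2 hL0
  have h3 : Real.log (Real.sqrt (Real.log X)) < Real.log (Real.log (I.Q (I.J + 1))) :=
    Real.log_lt_log hsqrt0 h1
  rw [Real.log_sqrt hL0.le] at h3
  have hJ : ((I.J + 1 : ℕ) : ℝ) = (I.J : ℝ) + 1 := by push_cast; ring
  rw [hJ] at h2
  have hpos : 0 < ((I.J : ℝ) + 1) ^ 2 := by positivity
  have h4 : Real.log (Real.log X) / 2 < η / (4 * ((I.J : ℝ) + 1) ^ 2) * (Real.log (I.P I.J) - 1) :=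
    h3.trans_le h2
  have h5 := mul_lt_mul_of_pos_left h4 (show (0 : ℝ) < 4 * ((I.J : ℝ) + 1) ^ 2 by positivity)
  have hid : 4 * ((I.J : ℝ) + 1) ^ 2 * (η / (4 * ((I.J : ℝ) + 1) ^ 2) * (Real.log (I.P I.J) - 1)) =
      η * (Real.log (I.P I.J) - 1) := by field_simp
  rw [hid] at h5
  linarith

/-- `2α_J + 2η/(J+1)² ≤ 1/2 - 2η` (`2J ≤ (J+1)²`). [folklore] -/
theorem two_alpha_add_le (hη : 0 < η) : 2 * alpha η I.J + 2 * η / ((I.J : ℝ) + 1) ^ 2 ≤ 1 / 2 - 2 * η := by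
  unfold alpha
  have hJ : (1 : ℝ) ≤ I.J := by exact_mod_cast I.one_le_J
  have hJ0 : (0 : ℝ) < I.J := by linarith
  have h1 : 2 * η / ((I.J : ℝ) + 1) ^ 2 ≤ η / I.J := by
    rw [div_le_div_iff₀ (by positivity) hJ0]
    nlinarith [mul_pos hη (show (0 : ℝ) < (I.J : ℝ) ^ 2 + 1 by positivity)]
  have h2 : 2 * (η * (1 + 1 / (2 * (I.J : ℝ)))) = 2 * η + η / I.J := by
    field_simp
  nlinarith [h1, h2]

/-- The exponent arithmetic of the point count: with `y = log P_J`, `x = v/H_J ∈ [y - 1/2, √L]·`, `lT = log T ≤ L`,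
`llT = log log T ≤ log L`, `2 (J+1)² log L < η (y - 1)` and `2α + 2η/(J+1)² ≤ 1/2 - 2η`:
`L · 2α + 4 (lT/x) llT ≤ L (1/2 - 2η)`. [folklore] -/
theorem count_exponent_le {η L lT llT x y Jr α : ℝ} (hL : 0 < L) (hlT : lT ≤ L) (hlT0 : 0 ≤ lT)
    (hllT : llT ≤ Real.log L) (hllT0 : 0 ≤ llT) (hy : 2 ≤ y) (hxy : y - 1 / 2 ≤ x) (hJr : 0 ≤ Jr)
    (hkey : 2 * (Jr + 1) ^ 2 * Real.log L < η * (y - 1))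
    (h2α : 2 * α + 2 * η / (Jr + 1) ^ 2 ≤ 1 / 2 - 2 * η) :
    L * (2 * α) + 4 * (lT / x) * llT ≤ L * (1 / 2 - 2 * η) := by
  have hx0 : 0 < x := by linarith
  have hy0 : 0 < y - 1 := by linarith
  have hJ0 : 0 < (Jr + 1) ^ 2 := by positivity
  -- `lT/x ≤ L/(y-1)`
  have h1 : lT / x ≤ L / (y - 1) := by
    rw [div_le_div_iff₀ hx0 hy0]
    calc lT * (y - 1) ≤ lT * x := mul_le_mul_of_nonneg_left (by linarith) hlT0
      _ ≤ L * x := mul_le_mul_of_nonneg_right hlT hx0.le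
  have h2 : 4 * (lT / x) * llT ≤ 4 * (L / (y - 1)) * Real.log L :=
    mul_le_mul (by linarith) hllT hllT0 (by positivity)
  -- `4 L log L/(y-1) ≤ 2ηL/(J+1)²`
  have h3 : 4 * (L / (y - 1)) * Real.log L ≤ L * (2 * η / (Jr + 1) ^ 2) := by
    rw [show 4 * (L / (y - 1)) * Real.log L = (4 * L * Real.log L) / (y - 1) by ring,
      show L * (2 * η / (Jr + 1) ^ 2) = (2 * η * L) / (Jr + 1) ^ 2 by ring,
      div_le_div_iff₀ hy0 hJ0]
    have := mul_le_mul_of_nonneg_left hkey.le (show 0 ≤ 2 * L by linarith)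
    linarith
  have h4 := mul_le_mul_of_nonneg_left h2α hL.le
  linarith

set_option maxHeartbeats 400000 in
/-- **Lemma 8 for one witness block** (§8.3): for `v ∈ ℐ_J`, the `1`-spaced points `t ∈ [T₀, T] ⊂ [0, T]` with
`|Q_{v,H_J}(1+it)| ≥ e^{-α_J v/H_J}` number at most `C₈ e^{(√log X)/2} X^{1/2 - 2η}` when `X^{1/4} ≤ T ≤ X`,
`log X ≥ 400`, `H₁ ≥ 2` (Lemma 8 with `P = e^{v/H_J}`, `V = e^{α_J v/H_J}`: `V² ≤ e^{(√log X)/2}`,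
`T^{2α_J} ≤ X^{2α_J}`, `exp(4 (log T/log P) log log T) ≤ X^{2η/(J+1)²}` by `loglogX_lt`).
[cite: MatomakiRadziwillAnnals2016, §8.3] -/
theorem card_witness_block_le {C₈ : ℝ} (hC₈ : 0 ≤ C₈) (h8 : (∀ (P T V : ℝ) (a : ℕ → ℂ) (𝒯 : Finset ℝ), 2 ≤ P → P ^ 2 ≤ T →
      Real.exp (Real.exp 4) ≤ T → 1 ≤ V → (∀ p, ‖a p‖ ≤ 1) → (∀ t ∈ 𝒯, |t| ≤ T) →
      (∀ t ∈ 𝒯, ∀ t' ∈ 𝒯, t ≠ t' → 1 ≤ |t - t'|) →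
      (∀ t ∈ 𝒯, V⁻¹ ≤ ‖∑ p ∈ (Finset.Icc ⌈P⌉₊ ⌊2 * P⌋₊).filter Nat.Prime,
          a p * (p : ℂ) ^ (-(1 + (t : ℂ) * Complex.I))‖) →
      ((Finset.card 𝒯 : ℕ) : ℝ) ≤ C₈ * V ^ 2 * T ^ (2 * Real.log V / Real.log P)
        * Real.exp (4 * (Real.log T / Real.log P) * Real.log (Real.log T))))
    (hη : 0 < η) (hη6 : η < 1 / 6) {c : ℕ → ℂ} (hc : ∀ p, ‖c p‖ ≤ 1) (hXe : Real.exp 1 ≤ X)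
    (hL : 400 ≤ Real.log X) {T₀ T : ℝ} (hT₀ : 0 ≤ T₀) (hXT : X ^ (1 / 4 : ℝ) ≤ T) (hTX : T ≤ X)
    (hH1 : 2 ≤ I.Hpar 1) {v : ℕ} (hv : v ∈ I.blocks I.J) (𝒯 : Finset ℝ)
    (h𝒯 : ∀ t ∈ 𝒯, t ∈ Set.Icc T₀ T ∧
      Real.exp (-(alpha η I.J * v / I.Hpar I.J)) ≤ ‖blockPrimePoly c (I.P I.J) (I.Q I.J) (I.Hpar I.J) v t‖)
    (hws : ∀ t ∈ 𝒯, ∀ t' ∈ 𝒯, t ≠ t' → 1 ≤ |t - t'|) :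
    (#𝒯 : ℝ) ≤ C₈ * Real.exp (Real.sqrt (Real.log X) / 2) * X ^ (1 / 2 - 2 * η : ℝ) := by
  classical
  have hη' : η ≤ 8 := by linarith
  have hη'' : η ≤ 1 / 6 := hη6.le
  set L := Real.log X with hLdef
  have hX0 : 0 < X := (Real.exp_pos 1).trans_le hXe
  have hL1 : 1 < L := by linarith
  have hL0 : 0 < L := by linarith
  have hJ1 : 1 ≤ I.J := I.one_le_J
  have hHJ : 2 ≤ I.Hpar I.J := hH1.trans (I.Hpar_one_le hη hη' hJ1)
  have hHJ0 : 0 < I.Hpar I.J := by linarith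
  have hXrpow : ∀ y : ℝ, X ^ y = Real.exp (L * y) := fun y => Real.rpow_def_of_pos hX0 y
  -- `T` is large: `T ≥ X^{1/4} = e^{L/4} ≥ e^{100}`
  have hT4 : Real.exp (L / 4) ≤ T := by rw [hXrpow] at hXT; convert hXT using 2; ring
  have hT0 : 0 < T := (Real.exp_pos _).trans_le hT4
  have hlogT : L / 4 ≤ Real.log T := by
    have := Real.log_le_log (Real.exp_pos _) hT4; rwa [Real.log_exp] at this
  have hlogTL : Real.log T ≤ L := Real.log_le_log hT0 hTX
  have heT : Real.exp (Real.exp 4) ≤ T :=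
    (Real.exp_le_exp.2 (by linarith [exp_four_le])).trans hT4
  have hlogT1 : 1 < Real.log T := by linarith
  have hllT : Real.log (Real.log T) ≤ Real.log L := Real.log_le_log (by linarith) hlogTL
  have hllT0 : 0 ≤ Real.log (Real.log T) := Real.log_nonneg hlogT1.le
  -- level-`J` facts
  have hlogPJ : 2 ≤ Real.log (I.P I.J) := I.two_le_logP hη hη'' hJ1
  have hQJ : Real.log (I.Q I.J) ≤ Real.sqrt L := by
    have := Real.log_le_log (I.pos_Q hJ1) I.Q_J_le; rwa [Real.log_exp] at this
  have hkey := I.loglogX_lt hL1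
  obtain ⟨hαpos, hαle⟩ := alpha_pos hη hη6 hJ1 (η := η) (i := I.J)
  have h2α := I.two_alpha_add_le hη
  set x : ℝ := (v : ℝ) / I.Hpar I.J with hx
  -- `x = v/H_J ∈ [log P_J - 1/2, log Q_J]`
  have hx1 : Real.log (I.P I.J) - 1 / 2 ≤ x := by
    have h := I.Hpar_mul_log_P_lt hv
    rw [hx, le_div_iff₀ hHJ0]
    nlinarith
  have hx2 : x ≤ Real.log (I.Q I.J) := by
    have h := I.exp_div_Hpar_le hη hη' hJ1 hv hHJ0
    have := Real.log_le_log (Real.exp_pos _) h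
    rwa [Real.log_exp] at this
  have hxpos : 0 < x := by linarith
  set P : ℝ := Real.exp x with hP
  set V : ℝ := Real.exp (alpha η I.J * x) with hV
  have hlogP : Real.log P = x := Real.log_exp x
  have hlogV : Real.log V = alpha η I.J * x := Real.log_exp _
  have h2P : 2 ≤ P := by
    have := Real.add_one_le_exp x
    rw [← hP] at this
    linarith
  have hP2T : P ^ 2 ≤ T := by
    have h1 : P ^ 2 = Real.exp (2 * x) := by rw [hP, ← Real.exp_nat_mul]; norm_num
    rw [h1]
    refine le_trans (Real.exp_le_exp.2 ?_) hT4
    have hsq : Real.sqrt L * Real.sqrt L = L := Real.mul_self_sqrt hL0.le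
    have h8L : 8 ≤ Real.sqrt L := by
      rw [show (8 : ℝ) = Real.sqrt (8 ^ 2) by rw [Real.sqrt_sq (by norm_num)]]
      exact Real.sqrt_le_sqrt (by linarith)
    nlinarith
  have hV1 : 1 ≤ V := Real.one_le_exp (by positivity)
  -- the coefficients
  obtain ⟨a, ha⟩ : ∃ a : ℕ → ℂ, a = fun p => if p ∈ ((Icc ⌈I.P I.J⌉₊ ⌊I.Q I.J⌋₊).filter Nat.Prime).filter
      (fun p : ℕ => Real.exp (v / I.Hpar I.J) ≤ p ∧ (p : ℝ) < Real.exp ((v + 1) / I.Hpar I.J))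
      then c p else 0 := ⟨_, rfl⟩
  have ha1 : ∀ p, ‖a p‖ ≤ 1 := fun p => by
    rw [ha]
    dsimp only
    split_ifs
    · exact hc p
    · simp
  have habs : ∀ t ∈ 𝒯, |t| ≤ T := fun t ht => by
    have h := (h𝒯 t ht).1
    rw [abs_of_nonneg (hT₀.trans h.1)]
    exact h.2
  have hlarge : ∀ t ∈ 𝒯, V⁻¹ ≤ ‖∑ p ∈ (Icc ⌈P⌉₊ ⌊2 * P⌋₊).filter Nat.Prime,
      a p * (p : ℂ) ^ (-(1 + (t : ℂ) * Complex.I))‖ := by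
    intro t ht
    have h := (h𝒯 t ht).2
    rw [blockPrimePoly_eq_sum_Icc c (I.P I.J) (I.Q I.J) hHJ v t] at h
    rw [hV, ← Real.exp_neg, ha]
    convert h using 3
    rw [hx]; ring
  have h := h8 P T V a 𝒯 h2P hP2T heT hV1 ha1 habs hws hlarge
  rw [hlogP, hlogV] at h
  have hexp1 : 2 * (alpha η I.J * x) / x = 2 * alpha η I.J := by field_simp
  rw [hexp1] at h
  refine h.trans ?_
  -- `V² ≤ e^{√L/2}`
  have hV2 : V ^ 2 ≤ Real.exp (Real.sqrt L / 2) := by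
    rw [hV, ← Real.exp_nat_mul]
    refine Real.exp_le_exp.2 ?_
    push_cast
    have : alpha η I.J * x ≤ 1 / 4 * Real.sqrt L :=
      mul_le_mul hαle (hx2.trans hQJ) hxpos.le (by norm_num)
    linarith
  -- `T^{2α_J} ≤ e^{2α_J L}`
  have hT2α : T ^ (2 * alpha η I.J) ≤ Real.exp (L * (2 * alpha η I.J)) := by
    rw [← hXrpow]
    exact Real.rpow_le_rpow hT0.le hTX (by linarith)
  have hT2α0 : 0 ≤ T ^ (2 * alpha η I.J) := Real.rpow_nonneg hT0.le _
  have hexp := count_exponent_le (α := alpha η I.J) hL0 hlogTL (by linarith) hllT hllT0 hlogPJ hx1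
    (Nat.cast_nonneg I.J) hkey h2α
  calc C₈ * V ^ 2 * T ^ (2 * alpha η I.J) * Real.exp (4 * (Real.log T / x) * Real.log (Real.log T))
      ≤ C₈ * Real.exp (Real.sqrt L / 2) * Real.exp (L * (2 * alpha η I.J)) *
          Real.exp (4 * (Real.log T / x) * Real.log (Real.log T)) := by
        refine mul_le_mul_of_nonneg_right ?_ (Real.exp_pos _).le
        exact mul_le_mul (mul_le_mul_of_nonneg_left hV2 hC₈) hT2α hT2α0 (by positivity)
    _ = C₈ * Real.exp (Real.sqrt L / 2) *
          Real.exp (L * (2 * alpha η I.J) + 4 * (Real.log T / x) * Real.log (Real.log T)) := by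
        rw [Real.exp_add]; ring
    _ ≤ C₈ * Real.exp (Real.sqrt L / 2) * X ^ (1 / 2 - 2 * η : ℝ) := by
        rw [hXrpow]
        exact mul_le_mul_of_nonneg_left (Real.exp_le_exp.2 hexp) (by positivity)

/-- **The points of `𝒯` are few** (§8.3: "`|𝒯| ≪ |ℐ_J| · T^{2α_J + o(1)} · T^η · X^{o(1)} ≪ T^{1/2-η} X^{o(1)}`"),
in the explicit form: for `X^{1/4} ≤ T ≤ X`, `log X ≥ 400`, `H₁ ≥ 2`, a `1`-spaced `𝒯 ⊂ [T₀, T]` (`T₀ ≥ 0`) each of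
whose points has a level-`J` witness satisfies `#𝒯 ≤ #ℐ_J · C₈ e^{(√log X)/2} X^{1/2 - 2η}`, `C₈` the constant
of Lemma 8 (sharp form, hypothesis `h8`). [cite: MatomakiRadziwillAnnals2016, §8.3] -/
theorem card_witness_le {C₈ : ℝ} (hC₈ : 0 ≤ C₈) (h8 : (∀ (P T V : ℝ) (a : ℕ → ℂ) (𝒯 : Finset ℝ), 2 ≤ P → P ^ 2 ≤ T →
      Real.exp (Real.exp 4) ≤ T → 1 ≤ V → (∀ p, ‖a p‖ ≤ 1) → (∀ t ∈ 𝒯, |t| ≤ T) →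
      (∀ t ∈ 𝒯, ∀ t' ∈ 𝒯, t ≠ t' → 1 ≤ |t - t'|) →
      (∀ t ∈ 𝒯, V⁻¹ ≤ ‖∑ p ∈ (Finset.Icc ⌈P⌉₊ ⌊2 * P⌋₊).filter Nat.Prime,
          a p * (p : ℂ) ^ (-(1 + (t : ℂ) * Complex.I))‖) →
      ((Finset.card 𝒯 : ℕ) : ℝ) ≤ C₈ * V ^ 2 * T ^ (2 * Real.log V / Real.log P)
        * Real.exp (4 * (Real.log T / Real.log P) * Real.log (Real.log T))))
    (hη : 0 < η) (hη6 : η < 1 / 6) {c : ℕ → ℂ} (hc : ∀ p, ‖c p‖ ≤ 1) (hXe : Real.exp 1 ≤ X)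
    (hL : 400 ≤ Real.log X) {T₀ T : ℝ} (hT₀ : 0 ≤ T₀) (hXT : X ^ (1 / 4 : ℝ) ≤ T) (hTX : T ≤ X)
    (hH1 : 2 ≤ I.Hpar 1) (𝒯 : Finset ℝ)
    (h𝒯 : ∀ t ∈ 𝒯, t ∈ Set.Icc T₀ T ∧ ∃ v ∈ I.blocks I.J,
      Real.exp (-(alpha η I.J * v / I.Hpar I.J)) ≤ ‖blockPrimePoly c (I.P I.J) (I.Q I.J) (I.Hpar I.J) v t‖)
    (hws : ∀ t ∈ 𝒯, ∀ t' ∈ 𝒯, t ≠ t' → 1 ≤ |t - t'|) :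
    (#𝒯 : ℝ) ≤ #(I.blocks I.J) * (C₈ * Real.exp (Real.sqrt (Real.log X) / 2) * X ^ (1 / 2 - 2 * η : ℝ)) := by
  classical
  -- the points witnessed by a fixed `v`
  have hv_bound : ∀ v ∈ I.blocks I.J,
      (#(𝒯.filter fun t => Real.exp (-(alpha η I.J * v / I.Hpar I.J)) ≤
          ‖blockPrimePoly c (I.P I.J) (I.Q I.J) (I.Hpar I.J) v t‖) : ℝ) ≤
        C₈ * Real.exp (Real.sqrt (Real.log X) / 2) * X ^ (1 / 2 - 2 * η : ℝ) := by
    intro v hv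
    refine I.card_witness_block_le hC₈ h8 hη hη6 hc hXe hL hT₀ hXT hTX hH1 hv _ ?_ ?_
    · intro t ht
      rw [Finset.mem_filter] at ht
      exact ⟨(h𝒯 t ht.1).1, ht.2⟩
    · intro t ht t' ht' hne
      exact hws t (Finset.mem_filter.1 ht).1 t' (Finset.mem_filter.1 ht').1 hne
  -- sum over the witnesses
  have hcover : 𝒯 ⊆ (I.blocks I.J).biUnion fun v => 𝒯.filter fun t =>
      Real.exp (-(alpha η I.J * v / I.Hpar I.J)) ≤
        ‖blockPrimePoly c (I.P I.J) (I.Q I.J) (I.Hpar I.J) v t‖ := by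
    intro t ht
    obtain ⟨v, hv, hle⟩ := (h𝒯 t ht).2
    exact Finset.mem_biUnion.2 ⟨v, hv, Finset.mem_filter.2 ⟨ht, hle⟩⟩
  calc (#𝒯 : ℝ) ≤ #((I.blocks I.J).biUnion fun v => 𝒯.filter fun t =>
        Real.exp (-(alpha η I.J * v / I.Hpar I.J)) ≤
          ‖blockPrimePoly c (I.P I.J) (I.Q I.J) (I.Hpar I.J) v t‖) := by
        exact_mod_cast Finset.card_le_card hcover
    _ ≤ ∑ v ∈ I.blocks I.J, (#(𝒯.filter fun t => Real.exp (-(alpha η I.J * v / I.Hpar I.J)) ≤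
          ‖blockPrimePoly c (I.P I.J) (I.Q I.J) (I.Hpar I.J) v t‖) : ℝ) := by
        exact_mod_cast Finset.card_biUnion_le
    _ ≤ ∑ v ∈ I.blocks I.J, C₈ * Real.exp (Real.sqrt (Real.log X) / 2) * X ^ (1 / 2 - 2 * η : ℝ) :=
        Finset.sum_le_sum hv_bound
    _ = #(I.blocks I.J) * (C₈ * Real.exp (Real.sqrt (Real.log X) / 2) * X ^ (1 / 2 - 2 * η : ℝ)) := by
        rw [Finset.sum_const, nsmul_eq_mul]

/-! ### The small values of `Q_{v,H}`: Lemma 9 for the cofactor polynomial -/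

end SieveIntervalSystem

namespace MatomakiRadziwillU

/-! ### The constants of Lemmas 3, 8, 9, 11 (made nonnegative) -/

/-- Lemma 8 (sharp form) holds with a nonnegative constant (PROVED in the tree: Lemma 7 is
`LFunctions.MatomakiRadziwill2016_lemma7_holds`). [cite: MatomakiRadziwillAnnals2016, Lemma 8] -/
theorem lemma8With_exists : ∃ C, 0 ≤ C ∧ (∀ (P T V : ℝ) (a : ℕ → ℂ) (𝒯 : Finset ℝ), 2 ≤ P → P ^ 2 ≤ T →
      Real.exp (Real.exp 4) ≤ T → 1 ≤ V → (∀ p, ‖a p‖ ≤ 1) → (∀ t ∈ 𝒯, |t| ≤ T) →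
      (∀ t ∈ 𝒯, ∀ t' ∈ 𝒯, t ≠ t' → 1 ≤ |t - t'|) →
      (∀ t ∈ 𝒯, V⁻¹ ≤ ‖∑ p ∈ (Finset.Icc ⌈P⌉₊ ⌊2 * P⌋₊).filter Nat.Prime,
          a p * (p : ℂ) ^ (-(1 + (t : ℂ) * Complex.I))‖) →
      ((Finset.card 𝒯 : ℕ) : ℝ) ≤ C * V ^ 2 * T ^ (2 * Real.log V / Real.log P)
        * Real.exp (4 * (Real.log T / Real.log P) * Real.log (Real.log T))) := by
  obtain ⟨C, hC⟩ := LFunctions.DirichletLargeValues.MatomakiRadziwill2016_lemma8_sharp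
    LFunctions.MatomakiRadziwill2016_lemma7_holds
  refine ⟨max C 0, le_max_right _ _, ?_⟩
  intro P T V a 𝒯 hP hPT hT hV ha habs hws hlarge
  have hT0 : 0 ≤ T := le_trans (by positivity) hPT
  calc (#𝒯 : ℝ) ≤ C * V ^ 2 * T ^ (2 * Real.log V / Real.log P)
        * Real.exp (4 * (Real.log T / Real.log P) * Real.log (Real.log T)) :=
        hC P T V a 𝒯 hP hPT hT hV ha habs hws hlarge
    _ = C * (V ^ 2 * T ^ (2 * Real.log V / Real.log P)
        * Real.exp (4 * (Real.log T / Real.log P) * Real.log (Real.log T))) := by ring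
    _ ≤ max C 0 * (V ^ 2 * T ^ (2 * Real.log V / Real.log P)
        * Real.exp (4 * (Real.log T / Real.log P) * Real.log (Real.log T))) :=
        mul_le_mul_of_nonneg_right (le_max_left _ _)
          (mul_nonneg (mul_nonneg (sq_nonneg _) (Real.rpow_nonneg hT0 _)) (Real.exp_nonneg _))
    _ = _ := by ring

/-- Lemma 9 holds with a nonnegative constant (PROVED in the tree:
`LFunctions.MatomakiRadziwill2016_lemma9_holds`). [cite: MatomakiRadziwillAnnals2016, Lemma 9] -/
theorem lemma9With_exists : ∃ C, 0 ≤ C ∧ (∀ (N : ℕ) (a : ℕ → ℂ) (T : ℝ) (𝒯 : Finset ℝ), 1 ≤ N → 1 ≤ T →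
      (∀ t ∈ 𝒯, |t| ≤ T) → (∀ t ∈ 𝒯, ∀ t' ∈ 𝒯, t ≠ t' → 1 ≤ |t - t'|) →
      ∑ t ∈ 𝒯, ‖∑ n ∈ Finset.Icc 1 N, a n * (n : ℂ) ^ (-((t : ℂ) * Complex.I))‖ ^ 2 ≤
        C * (N + (Finset.card 𝒯 : ℕ) * Real.sqrt T) * Real.log (2 * T) * ∑ n ∈ Finset.Icc 1 N, ‖a n‖ ^ 2) := by
  obtain ⟨C, hC⟩ := LFunctions.MatomakiRadziwill2016_lemma9_holds
  refine ⟨max C 0, le_max_right _ _, ?_⟩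
  intro N a T 𝒯 hN hT habs hws
  have hlog : 0 ≤ Real.log (2 * T) := Real.log_nonneg (by linarith)
  have hsum : 0 ≤ ∑ n ∈ Finset.Icc 1 N, ‖a n‖ ^ 2 := sum_nonneg fun n _ => by positivity
  calc _ ≤ C * (N + 𝒯.card * Real.sqrt T) * Real.log (2 * T) * ∑ n ∈ Finset.Icc 1 N, ‖a n‖ ^ 2 :=
        hC N a T 𝒯 hN hT habs hws
    _ = C * ((N + 𝒯.card * Real.sqrt T) * Real.log (2 * T) * ∑ n ∈ Finset.Icc 1 N, ‖a n‖ ^ 2) := by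
        ring
    _ ≤ max C 0 * ((N + 𝒯.card * Real.sqrt T) * Real.log (2 * T) * ∑ n ∈ Finset.Icc 1 N, ‖a n‖ ^ 2) :=
        mul_le_mul_of_nonneg_right (le_max_left _ _) (by positivity)
    _ = _ := by ring

/-- Lemma 11 (named fact) at `ε = 1/10`, with a nonnegative constant. [cite: MatomakiRadziwillAnnals2016, Lemma 11] -/
theorem lemma11With_of (h11 : MatomakiRadziwill2016_lemma11) : ∃ C, 0 ≤ C ∧ (∀ (P T : ℝ) (a : ℕ → ℂ) (𝒯 : Finset ℝ), 2 ≤ P → 2 ≤ T →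
      (∀ t ∈ 𝒯, |t| ≤ T) → (∀ t ∈ 𝒯, ∀ t' ∈ 𝒯, t ≠ t' → 1 ≤ |t - t'|) →
      ∑ t ∈ 𝒯, ‖∑ p ∈ (Finset.Icc ⌈P⌉₊ ⌊2 * P⌋₊).filter Nat.Prime,
          a p * (p : ℂ) ^ (-((t : ℂ) * Complex.I))‖ ^ 2 ≤
        C * (P + ((Finset.card 𝒯 : ℕ) : ℝ) * P * Real.exp (-(Real.log P / Real.log T ^ (2 / 3 + 1 / 10 : ℝ)))
            * Real.log T ^ 2)
          * ∑ p ∈ (Finset.Icc ⌈P⌉₊ ⌊2 * P⌋₊).filter Nat.Prime, ‖a p‖ ^ 2 / Real.log P) := by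
  obtain ⟨C, hC⟩ := h11 (1 / 10) (by norm_num)
  refine ⟨max C 0, le_max_right _ _, ?_⟩
  intro P T a 𝒯 hP hT habs hws
  have hlogP : 0 ≤ Real.log P := Real.log_nonneg (by linarith)
  have hP0 : 0 ≤ P := by linarith
  have hsum : 0 ≤ ∑ p ∈ (Icc ⌈P⌉₊ ⌊2 * P⌋₊).filter Nat.Prime, ‖a p‖ ^ 2 / Real.log P :=
    sum_nonneg fun p _ => by positivity
  have hfac : 0 ≤ P + (𝒯.card : ℝ) * P * Real.exp (-(Real.log P / Real.log T ^ (2 / 3 + 1 / 10 : ℝ)))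
      * Real.log T ^ 2 := by positivity
  calc _ ≤ C * (P + (𝒯.card : ℝ) * P * Real.exp (-(Real.log P / Real.log T ^ (2 / 3 + 1 / 10 : ℝ)))
        * Real.log T ^ 2) * ∑ p ∈ (Icc ⌈P⌉₊ ⌊2 * P⌋₊).filter Nat.Prime, ‖a p‖ ^ 2 / Real.log P :=
        hC P T a 𝒯 hP hT habs hws
    _ = C * ((P + (𝒯.card : ℝ) * P * Real.exp (-(Real.log P / Real.log T ^ (2 / 3 + 1 / 10 : ℝ)))
        * Real.log T ^ 2) * ∑ p ∈ (Icc ⌈P⌉₊ ⌊2 * P⌋₊).filter Nat.Prime, ‖a p‖ ^ 2 / Real.log P) := by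
        ring
    _ ≤ max C 0 * ((P + (𝒯.card : ℝ) * P * Real.exp (-(Real.log P / Real.log T ^ (2 / 3 + 1 / 10 : ℝ)))
        * Real.log T ^ 2) * ∑ p ∈ (Icc ⌈P⌉₊ ⌊2 * P⌋₊).filter Nat.Prime, ‖a p‖ ^ 2 / Real.log P) :=
        mul_le_mul_of_nonneg_right (le_max_left _ _) (mul_nonneg hfac hsum)
    _ = _ := by ring

/-- Lemma 3 (named fact) at `A = 2`, with a nonnegative constant. [cite: MatomakiRadziwillAnnals2016, Lemma 3] -/
theorem lemma3With_of (h3 : MatomakiRadziwill2016_lemma3) : ∃ C, 0 ≤ C ∧ (∀ f : ArithmeticFunction ℝ, f.IsMultiplicative → (∀ n, |f n| ≤ 1) →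
      ∀ X P Q t : ℝ, 2 ≤ P → P ≤ Q → Q ≤ X → Real.log X ^ (1 / 16 : ℝ) ≤ t → t ≤ X ^ (2 : ℝ) →
        ‖∑ n ∈ Finset.Icc ⌈X⌉₊ ⌊2 * X⌋₊,
            (f n : ℂ) * (n : ℂ) ^ (-(1 + (t : ℂ) * Complex.I)) / ((primeDivisorsIn P Q n : ℂ) + 1)‖ ≤
          C * (Real.log Q / (Real.log X ^ (1 / 16 : ℝ) * Real.log P)
            + Real.log X * Real.exp (-(Real.log X / (3 * Real.log Q)) * Real.log (Real.log X / Real.log Q)))) := by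
  obtain ⟨C, hC⟩ := h3 2 two_pos
  refine ⟨max C 0, le_max_right _ _, ?_⟩
  intro f hf hf1 X P Q t hP hPQ hQX ht htX
  refine (hC f hf hf1 X P Q t hP hPQ hQX ht htX).trans (mul_le_mul_of_nonneg_right (le_max_left _ _) ?_)
  have hlogP : 0 ≤ Real.log P := Real.log_nonneg (by linarith)
  have hlogQ : 0 ≤ Real.log Q := Real.log_nonneg (by linarith)
  have hlogX : 0 ≤ Real.log X := Real.log_nonneg (by linarith)
  exact add_nonneg (div_nonneg hlogQ (mul_nonneg (Real.rpow_nonneg hlogX _) hlogP))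
    (mul_nonneg hlogX (Real.exp_nonneg _))


/-- Lemma 9 for a polynomial `∑_{n ∈ s} d_n n^{-1-it}` supported on `s ⊆ [1, N]`:
`∑_{t ∈ 𝒯} |∑ d_n n^{-1-it}|² ≤ C₉ (N + |𝒯| √T) log(2T) ∑_{n ∈ s} |d_n|²/n²`. [folklore] -/
theorem lemma9_subset {C₉ : ℝ} (h9 : (∀ (N : ℕ) (a : ℕ → ℂ) (T : ℝ) (𝒯 : Finset ℝ), 1 ≤ N → 1 ≤ T →
      (∀ t ∈ 𝒯, |t| ≤ T) → (∀ t ∈ 𝒯, ∀ t' ∈ 𝒯, t ≠ t' → 1 ≤ |t - t'|) →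
      ∑ t ∈ 𝒯, ‖∑ n ∈ Finset.Icc 1 N, a n * (n : ℂ) ^ (-((t : ℂ) * Complex.I))‖ ^ 2 ≤
        C₉ * (N + (Finset.card 𝒯 : ℕ) * Real.sqrt T) * Real.log (2 * T) * ∑ n ∈ Finset.Icc 1 N, ‖a n‖ ^ 2)) (s : Finset ℕ) {N : ℕ}
    (hN : 1 ≤ N) (hs : s ⊆ Icc 1 N) (d : ℕ → ℂ) {T : ℝ} (hT : 1 ≤ T) (𝒯 : Finset ℝ)
    (habs : ∀ t ∈ 𝒯, |t| ≤ T) (hws : ∀ t ∈ 𝒯, ∀ t' ∈ 𝒯, t ≠ t' → 1 ≤ |t - t'|) :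
    ∑ t ∈ 𝒯, ‖∑ n ∈ s, d n * (n : ℂ) ^ (-(1 + (t : ℂ) * Complex.I))‖ ^ 2 ≤
      C₉ * (N + 𝒯.card * Real.sqrt T) * Real.log (2 * T) * ∑ n ∈ s, ‖d n‖ ^ 2 / (n : ℝ) ^ 2 := by
  classical
  have h1 : ∀ t : ℝ, ∑ n ∈ s, d n * (n : ℂ) ^ (-(1 + (t : ℂ) * Complex.I)) =
      ∑ n ∈ Icc 1 N, ((if n ∈ s then d n else 0) / n) * (n : ℂ) ^ (-((t : ℂ) * Complex.I)) := by
    intro t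
    rw [← sum_subset hs (fun n _ hns => by rw [if_neg hns, zero_div, zero_mul])]
    refine sum_congr rfl fun n hn => ?_
    rw [if_pos hn, MatomakiRadziwillLemma12.cpw_eq_inv_mul (mem_Icc.1 (hs hn)).1 t]
    ring
  have h2 : ∑ n ∈ Icc 1 N, ‖(if n ∈ s then d n else 0) / (n : ℂ)‖ ^ 2 =
      ∑ n ∈ s, ‖d n‖ ^ 2 / (n : ℝ) ^ 2 := by
    rw [← sum_subset hs (fun n _ hns => by rw [if_neg hns]; simp)]
    refine sum_congr rfl fun n hn => ?_
    rw [if_pos hn, norm_div, div_pow]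
    simp
  simp_rw [h1]
  rw [← h2]
  exact h9 N _ T 𝒯 hN hT habs hws

/-- On the points where `|Q| < B⁻¹`: `∑_{t : |Q(t)| < B⁻¹} |Q(t) R(t)|² ≤ B⁻¹² ∑_t |R(t)|²`. [folklore] -/
theorem sum_filter_small_le (Qf Rf : ℝ → ℂ) {B : ℝ} (hB : 0 < B) (𝒯 : Finset ℝ) :
    ∑ t ∈ 𝒯.filter (fun t => ‖Qf t‖ < B⁻¹), ‖Qf t * Rf t‖ ^ 2 ≤
      (B ^ 2)⁻¹ * ∑ t ∈ 𝒯, ‖Rf t‖ ^ 2 := by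
  rw [mul_sum]
  refine (sum_le_sum_of_subset_of_nonneg (filter_subset (fun t => ‖Qf t‖ < B⁻¹) 𝒯)
    fun t _ _ => by positivity).trans' ?_
  refine sum_le_sum fun t ht => ?_
  have h := (mem_filter.1 ht).2
  rw [norm_mul, mul_pow]
  refine mul_le_mul_of_nonneg_right ?_ (by positivity)
  rw [← inv_pow]
  exact pow_le_pow_left₀ (norm_nonneg _) h.le 2

/-- The cofactor polynomial as a polynomial with coefficients `d_m = b_m/(ω(m)+1)`. [folklore] -/
theorem blockCofactorPoly_eq (b : ℕ → ℂ) (X P Q H : ℝ) (v : ℕ) (t : ℝ) :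
    blockCofactorPoly b X P Q H v t =
      ∑ m ∈ Icc ⌈X * Real.exp (-(v / H))⌉₊ ⌊2 * (X * Real.exp (-(v / H)))⌋₊,
        (b m / ((primeDivisorsIn P Q m : ℂ) + 1)) * (m : ℂ) ^ (-(1 + (t : ℂ) * Complex.I)) := by
  unfold blockCofactorPoly
  rw [mul_assoc]
  exact sum_congr rfl fun m _ => by ring

/-- `#[X', 2X'] ≤ X' + 1` (integers), `X' ≥ 0`. [folklore] -/
theorem card_Icc_le {X' : ℝ} (hX' : 0 ≤ X') : (#(Icc ⌈X'⌉₊ ⌊2 * X'⌋₊) : ℝ) ≤ X' + 1 := by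
  rw [Nat.card_Icc]
  rcases le_or_gt ⌈X'⌉₊ (⌊2 * X'⌋₊ + 1) with hle | hlt
  · rw [Nat.cast_sub hle]; push_cast
    linarith [Nat.le_ceil X', Nat.floor_le (show 0 ≤ 2 * X' by linarith)]
  · rw [Nat.sub_eq_zero_of_le hlt.le]; push_cast; linarith

/-- `∑_{X' ≤ m ≤ 2X'} |d_m|²/m² ≤ 2/X'` for `|d_m| ≤ 1`, `X' ≥ 1`. [folklore] -/
theorem sum_norm_sq_div_sq_le {d : ℕ → ℂ} (hd : ∀ m, ‖d m‖ ≤ 1) {X' : ℝ} (hX' : 1 ≤ X') :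
    ∑ m ∈ Icc ⌈X'⌉₊ ⌊2 * X'⌋₊, ‖d m‖ ^ 2 / (m : ℝ) ^ 2 ≤ 2 / X' := by
  have hX'0 : 0 < X' := by linarith
  have hterm : ∀ m ∈ Icc ⌈X'⌉₊ ⌊2 * X'⌋₊, ‖d m‖ ^ 2 / (m : ℝ) ^ 2 ≤ 1 / X' ^ 2 := by
    intro m hm
    have hXm : X' ≤ m := Nat.ceil_le.1 (mem_Icc.1 hm).1
    have h1 : ‖d m‖ ^ 2 ≤ 1 := by
      have := hd m
      have h0 := norm_nonneg (d m)
      nlinarith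
    calc ‖d m‖ ^ 2 / (m : ℝ) ^ 2 ≤ 1 / (m : ℝ) ^ 2 := div_le_div_of_nonneg_right h1 (by positivity)
      _ ≤ 1 / X' ^ 2 := div_le_div_of_nonneg_left zero_le_one (by positivity)
          (pow_le_pow_left₀ hX'0.le hXm 2)
  calc ∑ m ∈ Icc ⌈X'⌉₊ ⌊2 * X'⌋₊, ‖d m‖ ^ 2 / (m : ℝ) ^ 2
      ≤ ∑ m ∈ Icc ⌈X'⌉₊ ⌊2 * X'⌋₊, (1 / X' ^ 2 : ℝ) := sum_le_sum hterm
    _ = #(Icc ⌈X'⌉₊ ⌊2 * X'⌋₊) * (1 / X' ^ 2) := by rw [sum_const, nsmul_eq_mul]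
    _ ≤ (X' + 1) * (1 / X' ^ 2) := by gcongr; exact card_Icc_le hX'0.le
    _ ≤ 2 / X' := by
        rw [show (X' + 1) * (1 / X' ^ 2) = (X' + 1) / X' ^ 2 by ring,
          div_le_div_iff₀ (by positivity) hX'0]
        nlinarith

/-- **Lemma 9 for the cofactor polynomial** `R_{v,H}(1+it) = ∑_{X' ≤ m ≤ 2X'} b_m m^{-1-it}/(ω(m)+1)`,
`X' = X e^{-v/H} ≥ 1`, `|b_m| ≤ 1`, over a `1`-spaced `𝒯 ⊂ [-T, T]`, `T ≥ 1`:
`∑_{t ∈ 𝒯} |R_{v,H}(1+it)|² ≤ C₉ (2X' + |𝒯| √T) log(2T) · (2/X')` ("`≪ (X e^{-v/H} + |𝒯| T^{1/2}) log(2T)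
· (X e^{-v/H})⁻¹`", §8.3). [cite: MatomakiRadziwillAnnals2016, §8.3] -/
theorem sum_norm_sq_cofactor_le {C₉ : ℝ} (hC₉ : 0 ≤ C₉) (h9 : (∀ (N : ℕ) (a : ℕ → ℂ) (T : ℝ) (𝒯 : Finset ℝ), 1 ≤ N → 1 ≤ T →
      (∀ t ∈ 𝒯, |t| ≤ T) → (∀ t ∈ 𝒯, ∀ t' ∈ 𝒯, t ≠ t' → 1 ≤ |t - t'|) →
      ∑ t ∈ 𝒯, ‖∑ n ∈ Finset.Icc 1 N, a n * (n : ℂ) ^ (-((t : ℂ) * Complex.I))‖ ^ 2 ≤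
        C₉ * (N + (Finset.card 𝒯 : ℕ) * Real.sqrt T) * Real.log (2 * T) * ∑ n ∈ Finset.Icc 1 N, ‖a n‖ ^ 2))
    {b : ℕ → ℂ} (hb : ∀ m, ‖b m‖ ≤ 1) (X P Q H : ℝ) (v : ℕ)
    (hX' : 1 ≤ X * Real.exp (-(v / H))) {T : ℝ} (hT : 1 ≤ T) (𝒯 : Finset ℝ)
    (habs : ∀ t ∈ 𝒯, |t| ≤ T) (hws : ∀ t ∈ 𝒯, ∀ t' ∈ 𝒯, t ≠ t' → 1 ≤ |t - t'|) :
    ∑ t ∈ 𝒯, ‖blockCofactorPoly b X P Q H v t‖ ^ 2 ≤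
      C₉ * (2 * (X * Real.exp (-(v / H))) + 𝒯.card * Real.sqrt T) * Real.log (2 * T) *
        (2 / (X * Real.exp (-(v / H)))) := by
  classical
  simp_rw [blockCofactorPoly_eq]
  generalize hX'def : X * Real.exp (-(v / H)) = X' at *
  have hX'0 : 0 < X' := by linarith
  have hN : 1 ≤ ⌊2 * X'⌋₊ := Nat.le_floor (by push_cast; linarith)
  have hs : Icc ⌈X'⌉₊ ⌊2 * X'⌋₊ ⊆ Icc 1 ⌊2 * X'⌋₊ := MatomakiRadziwillLemma12.Nn_subset hX'0
  have h := lemma9_subset h9 _ hN hs (fun m => b m / ((primeDivisorsIn P Q m : ℂ) + 1)) hT 𝒯 habs hws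
  refine h.trans ?_
  -- `|b_m/(ω(m)+1)| ≤ 1` (as in `Lichtman2020.norm_div_primeDivisorsIn_le`, not imported here)
  have hd : ∀ m, ‖b m / ((primeDivisorsIn P Q m : ℂ) + 1)‖ ≤ 1 := fun m => by
    rw [div_eq_mul_one_div, norm_mul]
    have h1 : ‖(1 : ℂ) / ((primeDivisorsIn P Q m : ℂ) + 1)‖ ≤ 1 := by
      rw [MatomakiRadziwillLemma12.norm_wt P Q m, div_le_one (by positivity)]
      linarith [(Nat.cast_nonneg (primeDivisorsIn P Q m) : (0 : ℝ) ≤ _)]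
    calc ‖b m‖ * ‖(1 : ℂ) / ((primeDivisorsIn P Q m : ℂ) + 1)‖ ≤ 1 * 1 :=
          mul_le_mul (hb m) h1 (norm_nonneg _) zero_le_one
      _ = 1 := one_mul _
  have hsum := sum_norm_sq_div_sq_le hd hX'
  have hNle : ((⌊2 * X'⌋₊ : ℕ) : ℝ) ≤ 2 * X' := Nat.floor_le (by linarith)
  have hlog : 0 ≤ Real.log (2 * T) := Real.log_nonneg (by linarith)
  have hfac : 0 ≤ C₉ * ((⌊2 * X'⌋₊ : ℕ) + 𝒯.card * Real.sqrt T) * Real.log (2 * T) := by positivity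
  calc C₉ * ((⌊2 * X'⌋₊ : ℕ) + 𝒯.card * Real.sqrt T) * Real.log (2 * T) *
        ∑ m ∈ Icc ⌈X'⌉₊ ⌊2 * X'⌋₊, ‖b m / ((primeDivisorsIn P Q m : ℂ) + 1)‖ ^ 2 / (m : ℝ) ^ 2
      ≤ C₉ * ((⌊2 * X'⌋₊ : ℕ) + 𝒯.card * Real.sqrt T) * Real.log (2 * T) * (2 / X') :=
        mul_le_mul_of_nonneg_left hsum hfac
    _ ≤ C₉ * (2 * X' + 𝒯.card * Real.sqrt T) * Real.log (2 * T) * (2 / X') := by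
        have : C₉ * ((⌊2 * X'⌋₊ : ℕ) + 𝒯.card * Real.sqrt T) ≤ C₉ * (2 * X' + 𝒯.card * Real.sqrt T) :=
          mul_le_mul_of_nonneg_left (by linarith) hC₉
        have h2 : 0 ≤ 2 / X' := by positivity
        exact mul_le_mul_of_nonneg_right (mul_le_mul_of_nonneg_right this hlog) h2

end MatomakiRadziwillU

end Literature.NumberTheory.Sieve
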